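import Mathlib
import Literature.MathematicalPhysics.QuantumFieldTheory.AnisotropicTwistedPartitionFunction
import Literature.MathematicalPhysics.QuantumFieldTheory.WilsonFinTorusMagneticSliceKernel
import Literature.MathematicalPhysics.QuantumFieldTheory.YangMillsOS
import HarnessLib

/-!
# Route `MagneticFluxCeiling`, crux `CoulombCeiling` (stmt-QuantumFields-25307): the registered stub `stub_spectralFloorAtRate`

The BC3 birth skeleton of the crux (namespace `Summit.QuantumFields.YangMills.Theses.MagneticFluxCeilingBirthK1`, sha
`723b4dd7…`) registers `stub_spectralFloorAtRate : SpectralFloorAtRateP`: for `SU(N)`, `N ≥ 2`, `r`, `β > 0`, central `z`, every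
spatial side `L ≥ 2`, the log-ratio `log [Z_z(L³×M)/Z_1(L³×M)]` (twist `z` in the spatial plane `q₀ = (0,1)`) has a RATE:
`−(1/M)·log ratio(L, M) → E` and `log ratio(L, M) ≥ −E·M − K` for `M ≥ M₀`.  Proof: with the top levels `μ₀, λ₀ > 0` of the
twisted and untwisted transfer operators (magnetic-sector trace formula
`exists_spectralData_wilsonFinTorusTensorTwistedPartition_magnetic`, applied to the tensors of `z` and of `1`),
`(m+2) log μ₀ ≤ log Z_z(m+2) ≤ m log μ₀ + log Z_z(2)` and likewise for `Z_1`, so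
`(m+2) log μ₀ − m log λ₀ − log Z_1(2) ≤ log ratio(m+2) ≤ m log μ₀ + log Z_z(2) − (m+2) log λ₀`; hence `E = log λ₀ − log μ₀`
(tHooft's magnetic flux energy of the box), `K = log Z_1(2) − 2 log λ₀`, `M₀ = 2`.  No summit is proved; the Yang–Mills mass
gap is NOT proved.  Route-independent imports (Literature only): the statement is spelled over `twistedPartitionFunctionAniso`.
-/

noncomputable section

open MeasureTheory Filter Topology Function
open Literature.MathematicalPhysics.QuantumFieldTheory

namespace Summit.QuantumFields.YangMills.Theorems.MagneticFluxCeiling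

/-- The registered stub's statement, letter for letter (birth skeleton of stmt-QuantumFields-25307, stub
`stub_spectralFloorAtRate : SpectralFloorAtRateP`). [problem-side] -/
def SpectralFloorAtRateP : Prop :=
  ∀ N : ℕ, 2 ≤ N → ∀ r : Literature.MathematicalPhysics.QuantumFieldTheory.LatticeRep (Matrix.specialUnitaryGroup (Fin N) ℂ), ∀ β : ℝ, 0 < β → ∀ z : Matrix.specialUnitaryGroup (Fin N) ℂ, z ∈ Subgroup.center (Matrix.specialUnitaryGroup (Fin N) ℂ) → ∀ L : ℕ, 2 ≤ L → ∃ E : ℝ, Tendsto (fun M : ℕ => -Real.log (Literature.MathematicalPhysics.QuantumFieldTheory.twistedPartitionFunctionAniso r.ρ β L M z ⟨((0 : Fin 4), (1 : Fin 4)), by decide⟩ / Literature.MathematicalPhysics.QuantumFieldTheory.twistedPartitionFunctionAniso r.ρ β L M 1 ⟨((0 : Fin 4), (1 : Fin 4)), by decide⟩) / (M : ℝ)) atTop (𝓝 E) ∧ ∃ K : ℝ, ∃ M₀ : ℕ, ∀ M : ℕ, M₀ ≤ M → -E * (M : ℝ) - K ≤ Real.log (Literature.MathematicalPhysics.QuantumFieldTheory.twistedPartitionFunctionAniso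 r.ρ β L M z ⟨((0 : Fin 4), (1 : Fin 4)), by decide⟩ / Literature.MathematicalPhysics.QuantumFieldTheory.twistedPartitionFunctionAniso r.ρ β L M 1 ⟨((0 : Fin 4), (1 : Fin 4)), by decide⟩)

/-- An affine sequence over `m + 2` tends to its slope: `(a·m + b)/(m+2) → a`. [problem-side] -/
theorem tendsto_affine_div (a b : ℝ) : Tendsto (fun m : ℕ => (a * (m : ℝ) + b) / ((m : ℝ) + 2)) atTop (𝓝 a) := by
  have h2 : Tendsto (fun m : ℕ => (m : ℝ) + 2) atTop atTop :=
    tendsto_atTop_add_const_right atTop 2 tendsto_natCast_atTop_atTop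
  have h0 : Tendsto (fun m : ℕ => (b - 2 * a) / ((m : ℝ) + 2)) atTop (𝓝 0) := tendsto_const_nhds.div_atTop h2
  have h := (tendsto_const_nhds (x := a)).add h0
  rw [add_zero] at h
  refine h.congr' (Eventually.of_forall fun m => ?_)
  have hm : ((m : ℝ) + 2) ≠ 0 := by positivity
  field_simp
  ring

section General

variable {G : Type*} [Group G] [TopologicalSpace G] [IsTopologicalGroup G] [CompactSpace G]
  [MeasurableSpace G] [BorelSpace G] [SecondCountableTopology G] {N : ℕ} (ρ : G →* Matrix (Fin N) (Fin N) ℂ)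

/-- **Two-sided log bounds of a spatially twisted box** `L_s³ × (m+2)` (twist `z` in the spatial plane `q₀ = (0,1)`, any
`z : G`, `β ≥ 0`, continuous unitary `ρ`): there is a top level `μ₀ > 0` with
`(m+2) log μ₀ ≤ log Z_z(m+2) ≤ m log μ₀ + log Z_z(2)` for every `m` (trace formula `Z_z(m+2) = Σⱼ μⱼ^{m+2}`, `0 ≤ μⱼ ≤ μ₀`).
[problem-side] -/
theorem exists_log_bounds_twisted (hρ : Continuous ρ) (hρu : ∀ g, ρ g ∈ Matrix.unitaryGroup (Fin N) ℂ) {β : ℝ}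
    (hβ : 0 ≤ β) (z : G) (Ls : ℕ) :
    ∃ μ₀ : ℝ, 0 < μ₀ ∧ ∀ m : ℕ,
      ((m : ℝ) + 2) * Real.log μ₀ ≤
          Real.log (twistedPartitionFunctionAniso ρ β Ls (m + 2) z ⟨((0 : Fin 4), (1 : Fin 4)), by decide⟩) ∧
        Real.log (twistedPartitionFunctionAniso ρ β Ls (m + 2) z ⟨((0 : Fin 4), (1 : Fin 4)), by decide⟩) ≤
          (m : ℝ) * Real.log μ₀ +
            Real.log (twistedPartitionFunctionAniso ρ β Ls 2 z ⟨((0 : Fin 4), (1 : Fin 4)), by decide⟩) := by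
  set q₀ : {p : Fin 4 × Fin 4 // p.1 < p.2} := ⟨((0 : Fin 4), (1 : Fin 4)), by decide⟩ with hq₀
  have hz1 : ∀ i : Fin 3, planeTwistTensor z q₀ i.castSucc 3 = 1 := fun i => planeTwistTensor_of_ne z _ (by simp [hq₀])
  obtain ⟨s, hcnt, lam, i₀, hlam, hpos, -, hZ⟩ :=
    exists_spectralData_wilsonFinTorusTensorTwistedPartition_magnetic (ρ := ρ) hρ hρu hβ hz1 Ls Ls Ls
  haveI : Countable s := hcnt
  have hZ' : ∀ m : ℕ, HasSum (fun i => lam i ^ (m + 2)) (twistedPartitionFunctionAniso ρ β Ls (m + 2) z q₀) :=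
    fun m => by rw [twistedPartitionFunctionAniso_def]; exact hZ m
  refine ⟨lam i₀, hpos, fun m => ?_⟩
  have hZpos : 0 < twistedPartitionFunctionAniso ρ β Ls (m + 2) z q₀ := twistedPartitionFunctionAniso_pos ρ hρ β Ls _ z q₀
  have hZ2 : 0 < twistedPartitionFunctionAniso ρ β Ls 2 z q₀ := twistedPartitionFunctionAniso_pos ρ hρ β Ls 2 z q₀
  -- `μ₀^{m+2} ≤ Z_z(m+2) ≤ μ₀^m Z_z(2)`
  have hlow : lam i₀ ^ (m + 2) ≤ twistedPartitionFunctionAniso ρ β Ls (m + 2) z q₀ :=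
    le_hasSum (hZ' m) i₀ fun j _ => pow_nonneg (hlam j).1 _
  have hup : twistedPartitionFunctionAniso ρ β Ls (m + 2) z q₀ ≤ lam i₀ ^ m * twistedPartitionFunctionAniso ρ β Ls 2 z q₀ := by
    have h2 : HasSum (fun i => lam i₀ ^ m * lam i ^ (0 + 2)) (lam i₀ ^ m * twistedPartitionFunctionAniso ρ β Ls 2 z q₀) :=
      (hZ' 0).mul_left _
    refine hasSum_le (fun i => ?_) (hZ' m) h2
    calc lam i ^ (m + 2) = lam i ^ m * lam i ^ (0 + 2) := by ring
      _ ≤ lam i₀ ^ m * lam i ^ (0 + 2) :=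
          mul_le_mul_of_nonneg_right (pow_le_pow_left₀ (hlam i).1 (hlam i).2 m) (pow_nonneg (hlam i).1 _)
  constructor
  · have h1 := Real.log_le_log (pow_pos hpos (m + 2)) hlow
    rw [Real.log_pow] at h1
    push_cast at h1
    exact h1
  · have h1 := Real.log_le_log hZpos hup
    rw [Real.log_mul (pow_pos hpos m).ne' hZ2.ne', Real.log_pow] at h1
    exact h1

end General

/-- **Registered stub `stub_spectralFloorAtRate` of the crux `CoulombCeiling` (stmt-QuantumFields-25307) — CLOSED.** [problem-side] -/
theorem stub_spectralFloorAtRate : SpectralFloorAtRateP := by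
  intro N _ r β hβ z _ L _
  set q₀ : {p : Fin 4 × Fin 4 // p.1 < p.2} := ⟨((0 : Fin 4), (1 : Fin 4)), by decide⟩ with hq₀
  have hρ := r.continuous
  have hρu := r.mem_unitary
  obtain ⟨μ₀, -, hbz⟩ := exists_log_bounds_twisted r.ρ hρ hρu hβ.le z L
  obtain ⟨lam₀, -, hb1⟩ := exists_log_bounds_twisted r.ρ hρ hρu hβ.le 1 L
  set E : ℝ := Real.log lam₀ - Real.log μ₀ with hE
  set Zz2 : ℝ := twistedPartitionFunctionAniso r.ρ β L 2 z q₀ with hZz2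
  set Z12 : ℝ := twistedPartitionFunctionAniso r.ρ β L 2 1 q₀ with hZ12
  -- the shifted log-ratio and its two-sided bounds
  set f : ℕ → ℝ := fun M => -Real.log (twistedPartitionFunctionAniso r.ρ β L M z q₀ /
    twistedPartitionFunctionAniso r.ρ β L M 1 q₀) / (M : ℝ) with hf
  have hratio : ∀ m : ℕ, Real.log (twistedPartitionFunctionAniso r.ρ β L (m + 2) z q₀ /
      twistedPartitionFunctionAniso r.ρ β L (m + 2) 1 q₀) =
      Real.log (twistedPartitionFunctionAniso r.ρ β L (m + 2) z q₀) -
        Real.log (twistedPartitionFunctionAniso r.ρ β L (m + 2) 1 q₀) := fun m =>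
    Real.log_div (twistedPartitionFunctionAniso_pos r.ρ hρ β L _ z q₀).ne'
      (twistedPartitionFunctionAniso_pos r.ρ hρ β L _ 1 q₀).ne'
  refine ⟨E, ?_, Real.log Z12 - 2 * Real.log lam₀, 2, fun M hM => ?_⟩
  · -- the rate: squeeze the shifted sequence between two affine sequences over `m + 2`
    rw [← tendsto_add_atTop_iff_nat 2]
    have hlowT := tendsto_affine_div E (2 * Real.log lam₀ - Real.log Zz2)
    have hupT := tendsto_affine_div E (Real.log Z12 - 2 * Real.log μ₀)
    refine tendsto_of_tendsto_of_tendsto_of_le_of_le hlowT hupT (fun m => ?_) (fun m => ?_)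
    · have hpos : (0 : ℝ) ≤ (m : ℝ) + 2 := by positivity
      have hcast : (((m + 2 : ℕ) : ℝ)) = (m : ℝ) + 2 := by push_cast; ring
      simp only [hf, hcast]
      rw [hratio m]
      refine div_le_div_of_nonneg_right ?_ hpos
      have := (hbz m).2
      have := (hb1 m).1
      simp only [hE]
      linarith
    · have hpos : (0 : ℝ) ≤ (m : ℝ) + 2 := by positivity
      have hcast : (((m + 2 : ℕ) : ℝ)) = (m : ℝ) + 2 := by push_cast; ring
      simp only [hf, hcast]
      rw [hratio m]
      refine div_le_div_of_nonneg_right ?_ hpos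
      have := (hbz m).1
      have := (hb1 m).2
      simp only [hE]
      linarith
  · -- the floor with `K = log Z_1(2) − 2 log λ₀`, `M₀ = 2`
    obtain ⟨m, rfl⟩ : ∃ m, M = m + 2 := ⟨M - 2, by omega⟩
    rw [hratio m]
    have hcast : (((m + 2 : ℕ) : ℝ)) = (m : ℝ) + 2 := by push_cast; ring
    rw [hcast]
    have := (hbz m).1
    have := (hb1 m).2
    simp only [hE]
    linarith

end Summit.QuantumFields.YangMills.Theorems.MagneticFluxCeiling

end
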